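import Literature.NumberTheory.LFunctions.DeBruijnNewmanFacts
import HarnessLib

/-!
# Ki–Kim–Lee 2009: all but finitely many zeros of `H_t` (`t > 0`) are real AND SIMPLE (simplicity clause), and `Λ < 1/2` (typed statements)

RH-FREE LITERATURE (label line, cell rh-crit C3): this module types the SIMPLICITY clause of the
Ki–Kim–Lee finiteness theorem — H. Ki, Y.-O. Kim, J. Lee, *On the de Bruijn–Newman constant*,
Adv. Math. 222 (2009) 281–306 (`[KiKimLee2009]`; the tree's tag for the theorem is "Thm. 1.3",
UNVERIFIED until the primary text is held: acquisition `acq-00145`, rt/ERRATA-lit-1.md E5). Nothing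
here bears on the truth of RH: the theorem concerns `H_t` for FIXED `t > 0`; RH is the statement at
`t = 0` (or `t`-uniformly as `t → 0⁺`), which no `t > 0` finiteness statement reaches.

## Source discipline (primary NOT held; typed from HELD SECONDARIES, both locators on every decl)

* `[NewmanWu2020]` C. M. Newman, W. Wu, *Constants of de Bruijn–Newman type in analytic number
  theory and statistical physics*, Bull. AMS 57 (2020) 595–614 = arXiv:1901.06596, p. 9,
  **Theorem 14** (verbatim): "For any `λ > 0`, all but finitely many zeros of `H_λ(·)` are real and
  simple." — attributed to [KKL] ("using saddle point methods and the properties of strong universal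
  multipliers, [KKL] proved").
* `[Ki2011]` H. Ki (a KKL author), *Zeros of zeta functions*, Comment. Math. Univ. St. Pauli 60
  (2011) 99–117, p. 104, **Theorem 3.7** (Ki–Kim–Lee, [29] = KKL 2009): "For any positive `λ`, all
  but finitely many zeros of `Ξ_λ(z)` are real and simple", `Ξ_λ(z) = ∫_{−∞}^{∞} Φ(t) e^{λt²} e^{izt} dt`,
  `Ξ_0 = Ξ`.

Normalisations. Newman–Wu's `H_λ(z) = ∫_{−∞}^{∞} e^{λt²} Φ_{NW}(t) e^{izt} dt` with
`Φ_{NW}(u) = Σ (4π²n⁴e^{9u/2} − 6πn²e^{5u/2}) e^{−πn² e^{2u}} = 2Φ(u/2)` (their (Phi), p. 4) and Ki's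
`Ξ_λ` are the same function, equal to `8 · H_{4λ}(2z)` for the tree's
`H_t = Literature.NumberTheory.LFunctions.deBruijnH t` (Rodgers–Tao eq. (1), `DeBruijnNewman.lean`;
Ki p. 104 makes the factor explicit: "`Λ = 4λ(0)`", de Bruijn's `λ ≥ 1/8` ↔ the tree's `t ≥ 1/2`).
Since `λ > 0 ↔ t = 4λ > 0` and the zeros correspond under `z ↦ 2z` (real ↔ real, simple ↔ simple),
the clause "for every `t > 0` all but finitely many zeros of `H_t` are real and simple" is
normalisation-independent and is what is typed.

## What the tree already holds (CITED, not restated)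

* REALITY clause = `Literature.NumberTheory.LFunctions.ki_kim_lee_finite` (`DeBruijnNewmanFacts.lean`),
  a THEOREM: `ki_kim_lee_finite_holds` (`XiHeatRayMonotone.lean`, explicit threshold: for
  `0 < t < 1/2` every zero with `|Re z| ≥ 4π e^{80/t}` is real; its docstring records "the
  simplicity clause of the printed theorem is not recorded" — this file records it).
* For `t > Λ` ALL zeros of `H_t` are real and simple: Csordas–Smith–Varga 1994 Thm. 2.2 =
  `Literature.NumberTheory.LFunctions.csordasSmithVarga_simple_zeros_holds` (`DeBruijnHSimpleZerosProofs.lean`);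
  hence the open content of the simplicity clause is the range `0 < t ≤ Λ` (empty iff RH, since
  `RH ↔ Λ = 0`, `riemannHypothesis_iff_deBruijnNewmanConst_eq_zero`; the companion Proofs file
  proves the `t > Λ` case and the cofinite ↔ threshold equivalence).
* de Bruijn's `Λ ≤ 1/2` = `hasOnlyRealZeros_deBruijnH_one_half[_holds]`,
  `deBruijnNewmanConst_mem_Icc` (CITED, not restated). KKL's strict `Λ < 1/2` is typed below
  (`ki_kim_lee_lt_one_half`, rt-lead ruling 2026-08-26T03:53Z amending rt/ASSIGNMENTS v1 item 3)
  from FOUR held secondaries: Ki 2011 **Thm. 3.8** p. 104 (a KKL author; normalisation explicit: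
  "`Λ = 4λ(0)` […] The de Bruijn–Newman constant `Λ` is less than `1/2`", de Bruijn's `λ ≥ 1/8` ↔
  `t ≥ 1/2`), Rodgers–Tao 2020 §1 (FMP p. 2: "the upper bound `Λ ≤ 1/2` of de Bruijn was sharpened
  slightly by Ki, Kim, and Lee to `Λ < 1/2`"), Saouter–Gourdon–Demichel 2011 p. 2282 ("Recently,
  Ki et al. [KKL09] have shown that `Λ < 1/2`"), Newman–Wu 2020 p. 9. Its printed proof (Newman–Wu
  p. 9: Thm. 14 + Pólya's infinitely many real zeros + the strict-strip lemma Thm. 13) needs KKL's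
  Thm. 13-type lemma, which is not in the tree — the fact is NOT discharged here.
* Ki 2011 p. 104 prints the `λ`-UNIFORM finiteness as an open QUESTION ("It should be important to
  ask if we can prove an uniform version of Theorem 3.7 …"); questions are not Literature facts and
  nothing is declared for it (the tree's uniform statement with explicit box is the Summit-side
  `DBNUniformFarZerosReal.lean`, K1 of cell rh-crit C3).

## Contents (namespace `Literature.NumberTheory.LFunctions`)

* `ki_kim_lee_cofinite_simple` — NAMED FACT (D-0014): for every `t > 0` there is `T` such that every
  zero `z` of `H_t` with `|Re z| ≥ T` is simple (`H_t'(z) ≠ 0`) — the simplicity clause in the same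
  threshold rendering as `ki_kim_lee_finite` (equivalent to "all but finitely many", because the
  zeros of `H_t`, `t ≥ 0`, lie in `|Im z| < 1` and are isolated; proved in `KiKimLeeProofs.lean`).
* `ki_kim_lee_real_simple_of` — the printed theorem (Newman–Wu Thm. 14 / Ki Thm. 3.7) in threshold
  form, assembled from the two clauses taken as hypotheses (the reality hypothesis is discharged by
  `ki_kim_lee_finite_holds` in the Proofs file, which may not be imported here without its heavy
  dependency chain).
* `ki_kim_lee_lt_one_half` — NAMED FACT (D-0014): `Λ < 1/2`, in the tree's `sInf`-free idiom "some
  `H_t` with `t < 1/2` has only real zeros"; `ki_kim_lee_lt_one_half_iff` — equivalence with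
  `deBruijnNewmanConst < 1/2` given de Bruijn's nonemptiness and Newman's lower bound (the facts
  `hasOnlyRealZeros_deBruijnH_one_half`, `bddBelow_setOf_hasOnlyRealZeros` of `DeBruijnNewman.lean`,
  both discharged in `DeBruijnNewmanConstProofs.lean`), and the one-way corollary
  `ki_kim_lee_lt_one_half.deBruijnNewmanConst_lt`.

## References

* H. Ki, Y.-O. Kim, J. Lee, *On the de Bruijn–Newman constant*, Adv. Math. 222 (2009) 281–306
  (primary, NOT held: acq-00145). [KiKimLee2009]
* C. M. Newman, W. Wu, Bull. AMS 57 (2020) 595–614 = arXiv:1901.06596, Thm. 14 (p. 9), Thm. 13.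
  [NewmanWu2020]
* H. Ki, *Zeros of zeta functions*, Comment. Math. Univ. St. Pauli 60 (2011) 99–117, Thm. 3.7,
  Thm. 3.8 and the remark between them (p. 104). [Ki2011]
* B. Rodgers, T. Tao, Forum Math. Pi 8 (2020) e6, §1 (FMP p. 2). [RodgersTaoFMP2020]
* Y. Saouter, X. Gourdon, P. Demichel, Math. Comp. 80 (2011) 2281–2287, §1 p. 2282.
  [SaouterGourdonDemichel2011]
* G. Csordas, W. Smith, R. S. Varga, Constr. Approx. 10 (1994) 107–129, Thm. 2.2.
  [CsordasSmithVarga1994]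
-/

noncomputable section

open Complex

namespace Literature.NumberTheory.LFunctions

/-- NAMED FACT — RH-FREE — **Ki–Kim–Lee 2009, simplicity clause** of "for any `λ > 0`, all but
finitely many zeros of `H_λ` are real and simple" (as printed in Newman–Wu 2020, Thm. 14, p. 9,
verbatim, and in Ki 2011, Thm. 3.7, p. 104, for `Ξ_λ(z) = 8H_{4λ}(2z)`; KKL's own theorem number is
unverified while the primary is not held — tree convention "Thm. 1.3", rt/ERRATA-lit-1 E5). Typed
in the threshold rendering of the reality clause `ki_kim_lee_finite` (which is a tree THEOREM,
`ki_kim_lee_finite_holds`, and is NOT restated): for every `t > 0` there is `T` such that every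
zero `z` of `H_t = deBruijnH t` with `|Re z| ≥ T` satisfies `H_t'(z) ≠ 0`. Equivalent to the cofinite
wording since the zeros of `H_t` (`t ≥ 0`) lie in `|Im z| < 1` and are isolated
(`KiKimLeeProofs.lean`). For `t > Λ` it holds with `T = 0` (all zeros simple, Csordas–Smith–Varga
Thm. 2.2 = `csordasSmithVarga_simple_zeros_holds`); the printed content beyond the tree is the range
`0 < t ≤ Λ`. Divergence: threshold instead of "all but finitely many"; tree normalisation `H_t`
(`t = 4λ`, `z ↦ 2z`). Users take `(h : ki_kim_lee_cofinite_simple)`.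
[cite: KiKimLee2009, Thm. 1.3 (simplicity clause; number unverified, primary not held acq-00145)]
[cite: NewmanWu2020, Thm. 14 p. 9] [cite: Ki2011, Thm. 3.7 p. 104] -/
def ki_kim_lee_cofinite_simple : Prop :=
  ∀ t : ℝ, 0 < t → ∃ T : ℝ, ∀ z : ℂ, deBruijnH t z = 0 → T ≤ |z.re| → deriv (deBruijnH t) z ≠ 0

/-- **Ki–Kim–Lee's finiteness theorem as printed** (Newman–Wu 2020 Thm. 14 p. 9; Ki 2011 Thm. 3.7
p. 104: "for any positive `λ`, all but finitely many zeros […] are real and simple"), threshold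
form, assembled from its two clauses: the reality clause `ki_kim_lee_finite` (a tree theorem,
`ki_kim_lee_finite_holds`, fed in by the Proofs file) and the simplicity clause
`ki_kim_lee_cofinite_simple`. For every `t > 0` there is `T` such that every zero `z` of `H_t` with
`|Re z| ≥ T` is real and simple. [cite: NewmanWu2020, Thm. 14 p. 9] [cite: Ki2011, Thm. 3.7 p. 104]
[cite: KiKimLee2009, Thm. 1.3 (number unverified)] -/
theorem ki_kim_lee_real_simple_of (h₁ : ki_kim_lee_finite) (h₂ : ki_kim_lee_cofinite_simple)
    {t : ℝ} (ht : 0 < t) :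
    ∃ T : ℝ, ∀ z : ℂ, deBruijnH t z = 0 → T ≤ |z.re| → z.im = 0 ∧ deriv (deBruijnH t) z ≠ 0 := by
  obtain ⟨T₁, hT₁⟩ := h₁ t ht
  obtain ⟨T₂, hT₂⟩ := h₂ t ht
  exact ⟨max T₁ T₂, fun z hz hT ↦
    ⟨hT₁ z hz ((le_max_left _ _).trans hT), hT₂ z hz ((le_max_right _ _).trans hT)⟩⟩

/-! ## `Λ < 1/2` (Ki–Kim–Lee 2009; Ki 2011 Thm. 3.8) — named fact -/

/-- NAMED FACT — RH-FREE — **Ki–Kim–Lee 2009: `Λ < 1/2`** (as printed in Ki 2011, Thm. 3.8 p. 104: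
"We define `Λ` by the de Bruijn–Newman constant `Λ = 4λ(0)`, where `λ(0)` denotes the infimum of the
set of real numbers `λ` such that the entire function `Ξ_λ` has only real zeros. The de Bruijn–Newman
constant `Λ` is less than `1/2`."; Rodgers–Tao 2020 §1, FMP p. 2: "sharpened slightly by Ki, Kim,
and Lee to `Λ < 1/2`"; Saouter–Gourdon–Demichel 2011 p. 2282; Newman–Wu 2020 p. 9; KKL's own
theorem number is unverified while the primary is not held — acq-00145, rt/ERRATA-lit-1 E5). In
the tree's normalisation `Λ = deBruijnNewmanConst` (Ki's factor `4` is exactly `t = 4λ`), typed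
`sInf`-free as "some `H_t` with `t < 1/2` has only real zeros" (↔ `Λ < 1/2`,
`ki_kim_lee_lt_one_half_iff`). The tree's weaker THEOREM is de Bruijn's `Λ ≤ 1/2`
(`hasOnlyRealZeros_deBruijnH_one_half_holds`, `deBruijnNewmanConst_mem_Icc`), CITED not restated.
Not discharged: the printed proof needs the strict-strip lemma (Newman–Wu Thm. 13), not in the
tree. Users take `(h : ki_kim_lee_lt_one_half)`.
[cite: KiKimLee2009, Thm. 1.1 (number unverified, primary not held acq-00145)]
[cite: Ki2011, Thm. 3.8 p. 104] [cite: RodgersTaoFMP2020, §1 (FMP p. 2)]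
[cite: SaouterGourdonDemichel2011, §1 p. 2282] [cite: NewmanWu2020, §2.4 p. 9] -/
def ki_kim_lee_lt_one_half : Prop :=
  ∃ t : ℝ, t < 1 / 2 ∧ HasOnlyRealZeros (deBruijnH t)

/-- The `sInf`-free rendering agrees with the printed `Λ < 1/2` as soon as
`{t | H_t has only real zeros}` is nonempty (de Bruijn, `hasOnlyRealZeros_deBruijnH_one_half`) and
bounded below (Newman, `bddBelow_setOf_hasOnlyRealZeros`). [cite: Ki2011, Thm. 3.8 p. 104] -/
theorem ki_kim_lee_lt_one_half_iff (hne : hasOnlyRealZeros_deBruijnH_one_half)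
    (hb : bddBelow_setOf_hasOnlyRealZeros) :
    ki_kim_lee_lt_one_half ↔ deBruijnNewmanConst < 1 / 2 := by
  have hS : {t : ℝ | HasOnlyRealZeros (deBruijnH t)}.Nonempty := ⟨1 / 2, hne⟩
  constructor
  · rintro ⟨t, ht, hreal⟩
    exact (csInf_le hb hreal).trans_lt ht
  · intro hlt
    obtain ⟨t, ht, htlt⟩ := (csInf_lt_iff hb hS).1 hlt
    exact ⟨t, htlt, ht⟩

/-- One-way corollary: the fact gives `Λ < 1/2` (only Newman's boundedness below is needed).
[cite: Ki2011, Thm. 3.8 p. 104] -/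
theorem ki_kim_lee_lt_one_half.deBruijnNewmanConst_lt (h : ki_kim_lee_lt_one_half)
    (hb : bddBelow_setOf_hasOnlyRealZeros) : deBruijnNewmanConst < 1 / 2 := by
  obtain ⟨t, ht, hreal⟩ := h
  exact (csInf_le hb hreal).trans_lt ht

end Literature.NumberTheory.LFunctions

end
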